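import Summits.BirchSwinnertonDyer.BirchSwinnertonDyer.Theorems.ErratumRoadFiveBigRepInvariants
import HarnessLib

/-!
# Route `UniversalToricDescent`, crux ♭B `TwinWanFrameAtThreeMult` (stmt-BirchSwinnertonDyer-26062 / 20694), line `membertower`,
# research stub `stub_wanFrameMultCube` — port step (P1) of the CUBE LOCUS (memo CUBE-LOCUS-PORT-MAP-w2g3): the BOUNDED form of
# bsd-stepL's invariants criterion for the big representation `M = T ⊗ Λ^*` — if the `ker κ`-fixed `p`-power torsion of `A` is
# killed by `p^k`, then the `G`-invariants of `bigRep κ ρ` are KILLED BY `p^k` (not zero, not divisible: bounded)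

Cell `bsd-wall` (run/shared/lean/pub/bsd-wall/), width seat `bsd-wall-utd-p2-w2` (prover g3, 2026-08-28);
`--supports stmt-BirchSwinnertonDyer-20694 --as helper`; Theses-free; pure algebra on the constructed module `bigRep κ ρ`
(lit g14's `Literature/…/AnticyclotomicBigGaloisRep.lean`), general `𝒪`, `p`, `A`, `G`.

## Context (numbers, not adjectives)

bsd-stepL's `BigRep.eq_zero_of_forall_bigRep_apply_eq` / `bigRep_invariants_eq_bot` (p-file `ErratumRoadFiveBigRepInvariants`,
§2 «THE INVARIANTS CRITERION») derive `M^G = 0` for `M = bigRep κ ρ` from «`A` has no nonzero `G`-fixed `p`-power torsion» — the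
shape of hypothesis (iv)/(dec) that feeds the EXACT member congruence `RoadFFMember.nonempty_memberCongruence` (LEAD g11's port to
p = 3: `hloc_extendScalars … (BigRep.hdec_geomPoints_of_padicTorsion …)`). On the cube locus (dec) fails: the twin's
`E(K_{∞,w})[3^∞]` is NON-ZERO but, by bsd-stepL's Lemma (L1) `TateTorsionRigidity.zpTower_branchT_exists_generator_fixed_torsion`
(binders `3 ≤ p`, `Mult W p`, a non-zero `p`-torsion point — the cube locus at p = 3), cyclic of order `p^k` on a `ℚ_p`-rational
generator, uniformly along the local tower. THEOREM T♭'s Selmer-level kernel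
(`SelmerControlDefect.smul_mem_map_selmer_of_forall_smul_invariants_eq_zero`, `SelmerDefectAssembly*`,
`LocalInvariantsTransfer.charIdeal_le_of_selmer_congruences_fLocal_printed`) consumes exactly «the constrained local invariants of
`M` are KILLED by `a = p^k`». This file is the big-module half of that input:

* §1 `apply_mem_fixed_of_forall_bigRep_apply_eq` — an invariant `Φ ∈ M^G` takes values in `A^{ker κ}`: for `κ g = 1` the action
  is `(g·Φ)(x) = ρ(g)(Φ(x))` (`bigRep_apply_apply`, no shift), so `ρ(g)(Φ x) = Φ x`.
* §2 **`pow_smul_apply_eq_zero_of_forall_bigRep_apply_eq`** / **`natCast_pow_smul_eq_zero_of_mem_bigRep_invariants`** /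
  **`C_pow_smul_eq_zero_of_mem_bigRep_invariants`** — THE BOUNDED INVARIANTS CRITERION: if every `ker κ`-fixed `p`-power-torsion
  element of `A` is killed by `p^k`, then every `Φ ∈ M^G` satisfies `p^k · Φ = 0`, in the three scalar currencies (pointwise `ℕ`,
  `ℕ` on `M`, `(C p)^k ∈ 𝒪⟦T⟧` — the last is the annihilator shape of `SelmerControlDefect`).
* §3 `C_pow_smul_eq_zero_of_mem_bigRep_restrict_invariants` — the same along `φ : H → G` (a decomposition group `G_{K_𝔭′} → G_K`;
  `bigRep_restrict`): hypothesis on the `φ(H) ∩ ker κ`-fixed torsion of `A` = «`E(K_{∞,w})[p^∞]` killed by `p^k`» = (L1).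
* §4 `C_pow_smul_eq_zero_of_mem_bigRep_restrict_invariants_of_cases` — the family form over constrained indices `ψ_v`, `v ∈ L₀`,
  each of BOUNDED-decomposition type (fixed torsion killed by `p^k`) or of inertia type (`κ ∘ ψ_v = 1`, `ρ ∘ ψ_v` trivial — there
  the invariants are all of `M`, which is NOT killed by `p^k`; so at inertia indices the EXACT road's divisibility is kept and the
  bounded form is offered only at decomposition indices: the theorem returns the disjunction the Selmer kernel can consume).

What is NOT here (port steps (P1b), (P2), (P3) of the memo): the dictionary `K̄`-torsion ↔ `ℚ̄₃`-torsion carrying (L1) to the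
hypothesis of §3 at `𝔭′`, the defect member congruence, the descent with slack. HONEST FRAMING: theorems only (no definition, no
named fact, no `sorry`); unconditional; closes nothing; BSD is not proved by any of this.

References: [Castella2018Erratum] Lemma 2.1 and Remark (2) (p. 2); [Castella2018] §2.1 (`𝒜 = T ⊗ Λ^*`, action `ρ ⊗ Ψ⁻¹`);
[Skinner2016PacificMC] §2.3; bsd-stepL memo PROOF-BDP §31.2 (E)/(L1).
-/

noncomputable section

open PowerSeries Literature.NumberTheory.GaloisRepresentations Literature.NumberTheory.EllipticCurves
  Literature.NumberTheory.EllipticCurves.BigRepModule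
  Summit.BirchSwinnertonDyer.Rank1Residual.X11b.BigRep

set_option linter.dupNamespace false
set_option autoImplicit false

namespace Summit.BirchSwinnertonDyer.BirchSwinnertonDyer.Theorems.UniversalToricDescentBigRepBoundedInvariants

variable {𝒪 : Type*} [CommRing 𝒪] {p : ℕ} [Fact p.Prime] {A : Type*} [AddCommGroup A] [Module 𝒪 A]
  [TopologicalSpace 𝒪] [TopologicalSpace A] [DiscreteTopology A]
  {G : Type*} [Group G] [TopologicalSpace G] [ContinuousMul G] [TopologicalSpace (PowerSeries 𝒪)]

/-! ### §1 Values of an invariant are fixed by the kernel of `κ` -/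

/-- **An invariant of `M = bigRep κ ρ` takes values in `A^{ker κ}`**: if `g·Φ = Φ` and `κ g = 1` then `ρ(g)(Φ x) = Φ x` for every
`x ∈ ℤ_p` (the shift `x ↦ x − κ g` is trivial). [cite: Castella2018, §2.1 (the action ρ ⊗ Ψ⁻¹ on 𝒜 = T ⊗ Λ^*)] -/
theorem apply_mem_fixed_of_forall_bigRep_apply_eq (κ : G →ₜ* Multiplicative ℤ_[p]) (ρ : ContinuousRep G 𝒪 A)
    (Φ : BigRepModule 𝒪 p A) (hΦ : ∀ g : G, bigRep κ ρ g Φ = Φ) {g : G} (hg : κ g = 1) (x : ℤ_[p]) :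
    ρ g (Φ x) = Φ x := by
  have h := DFunLike.congr_fun (hΦ g) x
  rw [bigRep_apply_apply, hg, toAdd_one, sub_zero] at h
  exact h

/-! ### §2 The bounded invariants criterion -/

/-- **THE BOUNDED INVARIANTS CRITERION (pointwise).** If every `a ∈ A` that is fixed by all `g` with `κ g = 1` and is `p`-power
torsion satisfies `p^k · a = 0`, then every `G`-invariant `Φ` of `bigRep κ ρ` satisfies `p^k · Φ(x) = 0` for all `x` (its values
are such `a`: §1 and `exists_torsion`). The EXACT criterion (`eq_zero_of_forall_bigRep_apply_eq`, `k = 0` after `a = 0`) is the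
case «no such `a` but `0`». [cite: Castella2018Erratum, Lemma 2.1 and Remark (2) (p. 2)] -/
theorem pow_smul_apply_eq_zero_of_forall_bigRep_apply_eq (κ : G →ₜ* Multiplicative ℤ_[p])
    (ρ : ContinuousRep G 𝒪 A) {k : ℕ}
    (hA : ∀ a : A, (∀ g : G, κ g = 1 → ρ g a = a) → (∃ j : ℕ, p ^ j • a = 0) → p ^ k • a = 0)
    (Φ : BigRepModule 𝒪 p A) (hΦ : ∀ g : G, bigRep κ ρ g Φ = Φ) (x : ℤ_[p]) : p ^ k • Φ x = 0 := by
  obtain ⟨j, hj⟩ := Φ.exists_torsion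
  exact hA (Φ x) (fun g hg ↦ apply_mem_fixed_of_forall_bigRep_apply_eq κ ρ Φ hΦ hg x) ⟨j, hj x⟩

variable [ContinuousSMul (PowerSeries 𝒪) (BigRepModule 𝒪 p A)]

/-- **The bounded invariants criterion, `ℕ`-scalar form on `M`**: `p^k · Φ = 0`. [cite: Castella2018Erratum, Lemma 2.1 and Remark (2) (p. 2)] -/
theorem natCast_pow_smul_eq_zero_of_mem_bigRep_invariants (κ : G →ₜ* Multiplicative ℤ_[p])
    (ρ : ContinuousRep G 𝒪 A) {k : ℕ}
    (hA : ∀ a : A, (∀ g : G, κ g = 1 → ρ g a = a) → (∃ j : ℕ, p ^ j • a = 0) → p ^ k • a = 0)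
    (Φ : BigRepModule 𝒪 p A) (hΦ : Φ ∈ (bigRep (p := p) κ ρ).toTopRep.ρ.invariants) :
    (p ^ k : ℕ) • Φ = 0 := by
  ext x
  rw [BigRepModule.nsmul_apply, BigRepModule.zero_apply]
  exact pow_smul_apply_eq_zero_of_forall_bigRep_apply_eq κ ρ hA Φ (fun g ↦ hΦ g) x

/-- **The bounded invariants criterion in the annihilator currency of `SelmerControlDefect`**: `(C p)^k · Φ = 0` for every
`G`-invariant `Φ` of `bigRep κ ρ` (`C c` acts as the scalar `c`, `BigRepModule.C_smul`). [cite: Castella2018Erratum, Lemma 2.1 and Remark (2) (p. 2)] -/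
theorem C_pow_smul_eq_zero_of_mem_bigRep_invariants (κ : G →ₜ* Multiplicative ℤ_[p])
    (ρ : ContinuousRep G 𝒪 A) {k : ℕ}
    (hA : ∀ a : A, (∀ g : G, κ g = 1 → ρ g a = a) → (∃ j : ℕ, p ^ j • a = 0) → p ^ k • a = 0)
    (Φ : BigRepModule 𝒪 p A) (hΦ : Φ ∈ (bigRep (p := p) κ ρ).toTopRep.ρ.invariants) :
    (C (p : 𝒪) : PowerSeries 𝒪) ^ k • Φ = 0 := by
  rw [← map_pow, C_smul, ← Nat.cast_pow, Nat.cast_smul_eq_nsmul]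
  exact natCast_pow_smul_eq_zero_of_mem_bigRep_invariants κ ρ hA Φ hΦ

/-! ### §3 Along a local map `φ : H → G` -/

variable {H : Type*} [Group H] [TopologicalSpace H] [ContinuousMul H]

/-- **Bounded local invariants at a DECOMPOSITION-type index.** Along `φ : H → G` (`G_{K_𝔭′} → G_K`): if every element of `A`
fixed by all `φ h` with `κ (φ h) = 1` (the local tower's Galois group) and `p`-power torsion is killed by `p^k` — at the twin:
«`E(K_{∞,w})[p^∞]` is killed by `p^k`», bsd-stepL's (L1) — then the invariants of `M|_H` are killed by `(C p)^k`.
[cite: Castella2018Erratum, Lemma 2.1 and Remark (2) (p. 2)] [cite: SilvermanATAEC1994, Thm. V.3.1 (d) (the source of k)] -/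
theorem C_pow_smul_eq_zero_of_mem_bigRep_restrict_invariants (κ : G →ₜ* Multiplicative ℤ_[p])
    (ρ : ContinuousRep G 𝒪 A) (φ : H →ₜ* G) {k : ℕ}
    (hA : ∀ a : A, (∀ h : H, κ (φ h) = 1 → ρ (φ h) a = a) → (∃ j : ℕ, p ^ j • a = 0) → p ^ k • a = 0)
    (Φ : BigRepModule 𝒪 p A) (hΦ : Φ ∈ (((bigRep (p := p) κ ρ).restrict φ).toTopRep).ρ.invariants) :
    (C (p : 𝒪) : PowerSeries 𝒪) ^ k • Φ = 0 := by
  rw [bigRep_restrict] at hΦ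
  exact C_pow_smul_eq_zero_of_mem_bigRep_invariants (κ.comp φ) (ρ.restrict φ)
    (fun a ha hj ↦ hA a (fun h hh ↦ by simpa only [ContinuousRep.restrict_apply] using ha h hh) hj) Φ hΦ

/-- The annihilator shape consumed by `SelmerControlDefect.smul_mem_map_selmer_of_forall_smul_invariants_eq_zero` at ONE
constrained index: `∀ w ∈ (M|_H)^H, (C p)^k • w = 0`. [cite: Castella2018Erratum, Lemma 2.1 and Remark (2) (p. 2)] -/
theorem forall_mem_bigRep_restrict_invariants_C_pow_smul_eq_zero (κ : G →ₜ* Multiplicative ℤ_[p])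
    (ρ : ContinuousRep G 𝒪 A) (φ : H →ₜ* G) {k : ℕ}
    (hA : ∀ a : A, (∀ h : H, κ (φ h) = 1 → ρ (φ h) a = a) → (∃ j : ℕ, p ^ j • a = 0) → p ^ k • a = 0) :
    ∀ w ∈ (((bigRep (p := p) κ ρ).restrict φ).toTopRep).ρ.invariants, (C (p : 𝒪) : PowerSeries 𝒪) ^ k • w = 0 :=
  fun w hw ↦ C_pow_smul_eq_zero_of_mem_bigRep_restrict_invariants κ ρ φ hA w hw

/-! ### §4 The family form over constrained indices -/

variable {ι : Type*} {Γv : ι → Type*} [∀ v, Group (Γv v)] [∀ v, TopologicalSpace (Γv v)]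
  [∀ v, ContinuousMul (Γv v)]

/-- **Family form.** For local maps `ψ_v : Γ_v → G` and constrained indices `L₀` each of BOUNDED-decomposition type (the
`ψ_v(Γ_v) ∩ ker κ`-fixed `p`-power torsion of `A` is killed by `p^k`) or of inertia type (`κ ∘ ψ_v = 1`, `ρ ∘ ψ_v` trivial):
at every `v ∈ L₀` EITHER the invariants of `M|_{Γ_v}` are killed by `(C p)^k` OR they are `(C p)^m`-divisible for every
`m ≥ 1` (bsd-stepL's `divisibleInvariants_bigRep_restrict_of_trivial`) — the two local shapes THEOREM T♭'s Selmer kernel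
(`SelmerDefectAssemblyMixed`, mixed places) consumes. [cite: Castella2018Erratum, §2 and Lemma 2.1 (p. 2)] -/
theorem bigRep_restrict_invariants_bounded_or_divisible_of_cases (κ : G →ₜ* Multiplicative ℤ_[p])
    (ρ : ContinuousRep G 𝒪 A) (ψ : ∀ v, Γv v →ₜ* G) (L₀ : Set ι) {k : ℕ}
    (hdiv : ∀ a : A, (∃ j : ℕ, p ^ j • a = 0) → ∃ b : A, p • b = a)
    (hL : ∀ v ∈ L₀,
      (∀ a : A, (∀ h : Γv v, κ (ψ v h) = 1 → ρ (ψ v h) a = a) → (∃ j : ℕ, p ^ j • a = 0) → p ^ k • a = 0) ∨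
        ((∀ h : Γv v, κ (ψ v h) = 1) ∧ ∀ (h : Γv v) (a : A), ρ (ψ v h) a = a)) :
    ∀ v ∈ L₀,
      (∀ w ∈ (((bigRep (p := p) κ ρ).restrict (ψ v)).toTopRep).ρ.invariants, (C (p : 𝒪) : PowerSeries 𝒪) ^ k • w = 0) ∨
      (∀ m : ℕ, 1 ≤ m → ∀ w ∈ (((bigRep (p := p) κ ρ).restrict (ψ v)).toTopRep).ρ.invariants,
        ∃ w' ∈ (((bigRep (p := p) κ ρ).restrict (ψ v)).toTopRep).ρ.invariants,
          (C (p : 𝒪) : PowerSeries 𝒪) ^ m • w' = w) := by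
  intro v hv
  rcases hL v hv with hbd | ⟨hκ, hρ⟩
  · exact Or.inl (forall_mem_bigRep_restrict_invariants_C_pow_smul_eq_zero κ ρ (ψ v) hbd)
  · exact Or.inr fun m hm ↦ divisibleInvariants_bigRep_restrict_of_trivial κ ρ (ψ v) hκ hρ hdiv m hm

end Summit.BirchSwinnertonDyer.BirchSwinnertonDyer.Theorems.UniversalToricDescentBigRepBoundedInvariants

end
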